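import Summits.QuantumFields.YangMills.Theorems.AllWindowsColdBoxBulkMidKernelDipoleOfLandau
import Summits.QuantumFields.YangMills.Theorems.AllWindowsColdBoxBoxHighLineLandauKernelGradDipole

/-!
# LINE-18 «BulkMidWindowSU2 birth v5» stub K1 `stub_kernelDipoleDecay`, BY NAME (crux `AllWindowsColdBox.BulkMidWindowSU2`, ⟨stmt-QuantumFields-24006⟩)

The dipole–dipole law of the Dirichlet box projection kernel, `|K_H(p,q)| ≤ c·(1 + log H)/(1 + ‖p − q‖₁)⁴` uniformly in the box including its
walls: by w2's gauge-change bridge ✓`dirKernelDipoleDecay_of_landauDipoleDecay` (✓p732120, `boxDirProjKernel = λ_p·hodgeQ⁻¹λ_q` via S2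
✓`stub_kernelHodgeForm`) it is LINE-20's U1c ✓`RestBlock.landauDipoleDecay` (✓p732596).  One line; standard axioms.

HONEST LABEL: closes the registered stub K1 of ONE critic-passed line on the R2ξ″ RECORD-rung crux ⟨24006⟩ by name; the line's remaining stubs
(`stub_potentialCorollaries`, `stub_harmonicMaxPrincipleFlux`, `stub_kernelMeanExpansionMidG`, `stub_kernelCovExpansionMidG`) stay OPEN; no crux, rung
or summit is proved; the Yang–Mills mass gap is NOT proved by this file.
-/

set_option autoImplicit false

noncomputable section

namespace Summit.QuantumFields.YangMills.Theorems.AllWindowsColdBoxBulkMidLine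

/-- **Stub K1 of LINE-18 (`stub_kernelDipoleDecay`), BY NAME**: the dipole–dipole decay of the Dirichlet box projection kernel. -/
theorem stub_kernelDipoleDecay : DirKernelDipoleDecay :=
  dirKernelDipoleDecay_of_landauDipoleDecay AllWindowsColdBoxBoxHighLine.RestBlock.landauDipoleDecay

end Summit.QuantumFields.YangMills.Theorems.AllWindowsColdBoxBulkMidLine

end
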